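import Summits.BirchSwinnertonDyer.BirchSwinnertonDyer.Theses.PlecticLegs
import Literature.NumberTheory.EllipticCurves.Selmer
import Literature.NumberTheory.EllipticCurves.GaloisAction
import Literature.NumberTheory.EllipticCurves.SelmerCorankHolds
import Literature.NumberTheory.EllipticCurves.AnalyticRank
import Literature.NumberTheory.EllipticCurves.Isogeny
import Literature.NumberTheory.EllipticCurves.SelmerParityTotallyReal
import Literature.NumberTheory.EllipticCurves.ComplexMultiplicationDeuringOrdinarySplit
import HarnessLib

/-!
# Crux `PlecticLegs.PlecticPointsLB` (stmt-BirchSwinnertonDyer-17518), line `Sketch`, stub B `stub_parity` —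
# reduction to Nekovář 2013 Theorem A + Deuring's criterion + the junk bridge (worker, 2026-08-17)

The registered stub B of `Cruxes/PlecticPointsLB/Lines/Sketch.lean` (= stub B of `Lines/selmer_ladder.lean`)
reads: for `F` totally real, `V/F` elliptic and an ADMISSIBLE prime `p` (`5 ≤ p`, `p ∤ disc F`, `ρ̄_{V,p}`
irreducible, good ordinary above `p` read on Mathlib's `localPolynomial`),
`1 ≤ ord_{s=1} L(V/F,s) → corank_{ℤ_p} Sel_{p^∞}(V/F) ≡ ord_{s=1} L(V/F,s) (mod 2)`.

In print this is J. Nekovář, *Some consequences of a formula of Mazur and Rubin for arithmetic local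
constants*, Algebra & Number Theory 7 (2013) 1101–1120, **Theorem A** (`s_p(E/F) ≡ r_an(E/F) (mod 2)` for
`E` over a totally real `F`, in the cases (1) no CM, (2) CM and `[F:ℚ]` odd, (3) CM by `K'` with `p` split
in `K'`), whose proof (Selmer complexes, the Cornut–Vatsal / Aflalo–Nekovář Euler system, the Mazur–Rubin
formula) is far outside the tree: the stub is NOT provable here outright. This file records, sorry-free,
exactly what it reduces to, on two named facts landed today in `Literature/NumberTheory/EllipticCurves/`:

* `Literature.NumberTheory.EllipticCurves.Nekovar2013_theoremA` (`SelmerParityTotallyReal.lean`, p164451,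
  ACCEPTED) — Theorem A: `s_p` verbatim as `mordellWeilRank + shaCorank p`, `r_an` as `analyticRank` UNDER
  `HasEntireLFunction` (the printed `r_an` is the order of the MEROMORPHIC continuation given by potential
  modularity; the tree's `analyticRank` is that number exactly when the continuation is entire,
  `WeierstrassCurve.subsingleton_entireContinuations`, and junk otherwise), CM = `HasCM`,
  "`p` splits in the CM field" = `Nonempty (V.geomEndRing →+* ℤ_[p])`;
* `Literature.NumberTheory.EllipticCurves.Deuring1941_nonempty_geomEndRing_ringHom_padicInt_of_ordinary`
  (`ComplexMultiplicationDeuringOrdinarySplit.lean`, p164475, ACCEPTED) — Deuring's criterion (Lang,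
  *Elliptic Functions*, Ch. 13 §4 Thm. 12 with §2 Thm. 5 (iii)): a CM curve with good ORDINARY reduction at
  a prime above `p` has `p` split in its CM field. This is what puts a CM curve at an admissible prime into
  case (3).

Proved here:

* `selmerCorank_mod_two_eq_analyticRank_of_ordinary` — from the two facts: for every `V/F` (`F` totally
  real), every prime `p` above which `V` is good ordinary, IF `L(V/F,s)` is entire then `s_p ≡ r_an (mod 2)`
  (non-CM: case (1); CM: Deuring + case (3), via the Literature corollaries
  `nonempty_geomEndRing_ringHom_padicInt_of_forall_ordinary` and
  `selmerCorank_mod_two_eq_analyticRank_of_hasCM_imp`). Of the admissibility hypotheses only ordinarity is used;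
* `stub_parity_of_nekovar_of_deuring` — the registered stub VERBATIM from the two facts and ONE more explicit
  hypothesis, the JUNK BRIDGE `hJ : ∀ F V, V.analyticRank ≠ 0 → V.HasEntireLFunction` (the stub's guard
  `1 ≤ V.analyticRank` must be converted into `HasEntireLFunction`; over `ℚ` this is the tree theorem
  `WeierstrassCurve.hasEntireLFunction_of_analyticRank_ne_zero` (`BSDRootNumberNoContinuationProofs`:
  `Σ aₙ n⁻ˢ` does not converge absolutely at `s = 1` because `a_{p²} = a_p² − p`), but over a number field
  `F ≠ ℚ` that argument fails — `aₙ` collects all ideals of norm `n` and conjugate primes above `p` can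
  cancel — so it is kept as a hypothesis, NOT claimed);
* `stub_parity_of_parity` — the same with the two facts replaced by their proved combination, to display the
  exact residual content: stub B = (p-parity at good ordinary `p` for curves with entire `L`-function) +
  (junk bridge); and `stub_parity_of_nekovar_of_deuring'`, the factorisation through it.

Nothing here is landed under `Theorems/` (the gate accepts under `--supports` only the registered stub proved
outright); this file is crux-tree evidence (`Cruxes/PlecticPointsLB/Lines/Sketch_stub_parity.lean`).
-/

set_option linter.dupNamespace false -- single-conjunct summit: Sub = Summit (D-0017)

open NumberField IsDedekindDomain

namespace Summit.BirchSwinnertonDyer.BirchSwinnertonDyer.Theorems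

open Literature.NumberTheory.EllipticCurves

/-! ## What the two facts give: `p`-parity at a good ordinary prime, for curves with entire `L` -/

/-- **`p`-parity over a totally real field at a prime of good ordinary reduction, from Nekovář's
Theorem A and Deuring's criterion.** For `F` totally real, `V/F` elliptic and a prime `p` above which
`V` has good ordinary reduction at every `𝔭` (degree `2`, `p ∤ a_𝔭`), if `L(V/F,s)` is entire then
`corank_{ℤ_p} Sel_{p^∞}(V/F) ≡ ord_{s=1} L(V/F,s) (mod 2)`: a non-CM curve is case (1) of Theorem A;
a CM curve is case (3), since ordinarity above `p` splits `p` in the CM field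
(`nonempty_geomEndRing_ringHom_padicInt_of_forall_ordinary`, Deuring); `s_p = selmerCorank` by the corank
identity (inside `selmerCorank_mod_two_eq_analyticRank_of_hasCM_imp`).
[cite: Nekovar2013, Thm. A] [cite: Lang1987, Ch. 13 §4 Thm. 12] -/
theorem selmerCorank_mod_two_eq_analyticRank_of_ordinary (hN : Nekovar2013_theoremA)
    (hD : Deuring1941_nonempty_geomEndRing_ringHom_padicInt_of_ordinary)
    {F : Type} [Field F] [NumberField F] [IsTotallyReal F] (V : WeierstrassCurve F) [V.IsElliptic]
    (p : ℕ) [Fact p.Prime]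
    (hord : ∀ 𝔭 : HeightOneSpectrum (𝓞 F), (p : 𝓞 F) ∈ 𝔭.asIdeal →
      ((V.baseChange (𝔭.adicCompletion F)).localPolynomial (𝔭.adicCompletionIntegers F)).natDegree = 2 ∧
      ¬ (p : ℤ) ∣ ((V.baseChange (𝔭.adicCompletion F)).localPolynomial
        (𝔭.adicCompletionIntegers F)).coeff 1)
    (hL : V.HasEntireLFunction) : V.selmerCorank p % 2 = V.analyticRank % 2 :=
  selmerCorank_mod_two_eq_analyticRank_of_hasCM_imp V p hN
    (fun hCM => nonempty_geomEndRing_ringHom_padicInt_of_forall_ordinary hD V hCM p hord) hL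

/-! ## The registered stub, conditionally -/

/-- **Stub B `stub_parity` from Nekovář 2013 Thm. A, Deuring's criterion and the junk bridge.** The
registered signature VERBATIM (all admissibility binders kept; only ordinarity above `p` and the guard
`1 ≤ analyticRank` are used), under three explicit hypotheses: `hN` (Theorem A, named fact
`Nekovar2013_theoremA`), `hD` (Deuring, named fact
`Deuring1941_nonempty_geomEndRing_ringHom_padicInt_of_ordinary`) and the JUNK BRIDGE
`hJ : analyticRank ≠ 0 → HasEntireLFunction` for elliptic curves over number fields — needed to turn the
stub's guard into the continuation hypothesis of Theorem A; a theorem of the tree over `ℚ`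
(`WeierstrassCurve.hasEntireLFunction_of_analyticRank_ne_zero`), NOT known to the tree (and not claimed)
over `F ≠ ℚ`, where the non-absolute-convergence argument at `s = 1` breaks down. Proof: `hJ` gives
`HasEntireLFunction`, then `selmerCorank_mod_two_eq_analyticRank_of_ordinary`. [cite: Nekovar2013, Thm. A] -/
theorem stub_parity_of_nekovar_of_deuring (hN : Nekovar2013_theoremA)
    (hD : Deuring1941_nonempty_geomEndRing_ringHom_padicInt_of_ordinary)
    (hJ : ∀ (F : Type) [Field F] [NumberField F] (V : WeierstrassCurve F) [V.IsElliptic],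
      V.analyticRank ≠ 0 → V.HasEntireLFunction) :
    ∀ (F : Type) [Field F] [NumberField F] [NumberField.IsTotallyReal F] (V : WeierstrassCurve F)
      [V.IsElliptic] (p : ℕ) [Fact p.Prime], 5 ≤ p → ¬ ((p : ℤ) ∣ NumberField.discr F) →
      V.HasIrreducibleModPGaloisRep p →
      (∀ 𝔭 : HeightOneSpectrum (𝓞 F), (p : 𝓞 F) ∈ 𝔭.asIdeal →
        ((V.baseChange (𝔭.adicCompletion F)).localPolynomial (𝔭.adicCompletionIntegers F)).natDegree = 2 ∧
        ¬ (p : ℤ) ∣ ((V.baseChange (𝔭.adicCompletion F)).localPolynomial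
          (𝔭.adicCompletionIntegers F)).coeff 1) →
      1 ≤ V.analyticRank → V.selmerCorank p % 2 = V.analyticRank % 2 := by
  intro F _ _ _ V _ p _ _h5 _hdisc _hirr hord hr
  exact selmerCorank_mod_two_eq_analyticRank_of_ordinary hN hD V p hord (hJ F V (by omega))

/-- **The residual content of stub B, displayed**: the registered signature follows from
(i) `p`-parity at primes of good ordinary reduction for curves over totally real fields WITH ENTIRE
`L`-FUNCTION (the conclusion of `selmerCorank_mod_two_eq_analyticRank_of_ordinary`, i.e. Nekovář +
Deuring) and (ii) the junk bridge. Conversely (i) is literally the stub with `HasEntireLFunction` in place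
of the guard, so modulo the junk convention for `analyticRank` stub B IS Nekovář's theorem at admissible
primes. [cite: Nekovar2013, Thm. A] -/
theorem stub_parity_of_parity
    (hP : ∀ (F : Type) [Field F] [NumberField F] [NumberField.IsTotallyReal F] (V : WeierstrassCurve F)
      [V.IsElliptic] (p : ℕ) [Fact p.Prime],
      (∀ 𝔭 : HeightOneSpectrum (𝓞 F), (p : 𝓞 F) ∈ 𝔭.asIdeal →
        ((V.baseChange (𝔭.adicCompletion F)).localPolynomial (𝔭.adicCompletionIntegers F)).natDegree = 2 ∧
        ¬ (p : ℤ) ∣ ((V.baseChange (𝔭.adicCompletion F)).localPolynomial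
          (𝔭.adicCompletionIntegers F)).coeff 1) →
      V.HasEntireLFunction → V.selmerCorank p % 2 = V.analyticRank % 2)
    (hJ : ∀ (F : Type) [Field F] [NumberField F] (V : WeierstrassCurve F) [V.IsElliptic],
      V.analyticRank ≠ 0 → V.HasEntireLFunction) :
    ∀ (F : Type) [Field F] [NumberField F] [NumberField.IsTotallyReal F] (V : WeierstrassCurve F)
      [V.IsElliptic] (p : ℕ) [Fact p.Prime], 5 ≤ p → ¬ ((p : ℤ) ∣ NumberField.discr F) →
      V.HasIrreducibleModPGaloisRep p →
      (∀ 𝔭 : HeightOneSpectrum (𝓞 F), (p : 𝓞 F) ∈ 𝔭.asIdeal →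
        ((V.baseChange (𝔭.adicCompletion F)).localPolynomial (𝔭.adicCompletionIntegers F)).natDegree = 2 ∧
        ¬ (p : ℤ) ∣ ((V.baseChange (𝔭.adicCompletion F)).localPolynomial
          (𝔭.adicCompletionIntegers F)).coeff 1) →
      1 ≤ V.analyticRank → V.selmerCorank p % 2 = V.analyticRank % 2 := by
  intro F _ _ _ V _ p _ _h5 _hdisc _hirr hord hr
  exact hP F V p hord (hJ F V (by omega))

/-- The parity hypothesis `hP` of `stub_parity_of_parity` is supplied by the two named facts
(`selmerCorank_mod_two_eq_analyticRank_of_ordinary`), so `stub_parity_of_nekovar_of_deuring` factors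
through it. [cite: Nekovar2013, Thm. A] -/
theorem stub_parity_of_nekovar_of_deuring' (hN : Nekovar2013_theoremA)
    (hD : Deuring1941_nonempty_geomEndRing_ringHom_padicInt_of_ordinary)
    (hJ : ∀ (F : Type) [Field F] [NumberField F] (V : WeierstrassCurve F) [V.IsElliptic],
      V.analyticRank ≠ 0 → V.HasEntireLFunction) :
    ∀ (F : Type) [Field F] [NumberField F] [NumberField.IsTotallyReal F] (V : WeierstrassCurve F)
      [V.IsElliptic] (p : ℕ) [Fact p.Prime], 5 ≤ p → ¬ ((p : ℤ) ∣ NumberField.discr F) →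
      V.HasIrreducibleModPGaloisRep p →
      (∀ 𝔭 : HeightOneSpectrum (𝓞 F), (p : 𝓞 F) ∈ 𝔭.asIdeal →
        ((V.baseChange (𝔭.adicCompletion F)).localPolynomial (𝔭.adicCompletionIntegers F)).natDegree = 2 ∧
        ¬ (p : ℤ) ∣ ((V.baseChange (𝔭.adicCompletion F)).localPolynomial
          (𝔭.adicCompletionIntegers F)).coeff 1) →
      1 ≤ V.analyticRank → V.selmerCorank p % 2 = V.analyticRank % 2 :=
  stub_parity_of_parity
    (fun _F _ _ _ V _ p _ hord hL => selmerCorank_mod_two_eq_analyticRank_of_ordinary hN hD V p hord hL)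
    hJ

end Summit.BirchSwinnertonDyer.BirchSwinnertonDyer.Theorems
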